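import Mathlib
import Summits.Ventures.HodgeRepro0.P1FermatCertDefs

/-!
# p1 — the extended certificate predicate (Shioda 1979 quasi-decomposability + Aoki's standard elements)

`IsShiodaCertExt m Phi S alpha extra blocks` extends `IsShiodaCert` (P1FermatCertDefs) in two ways, following
proofs/p6-fermat-reach.md §5.7 (p6) and proofs/p1-lattice-calculus.md (X23): (i) a list `extra` of cancelling pairs
{a, m−a} may be adjoined to γ = ∏_(u∈S) u·α before decomposing (Shioda 1979: the class is algebraic iff the class
with the pairs adjoined is — Lemma 4.1 with a 0-dimensional Fermat variety); (ii) a block may also be one of Aoki's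
p-standard elements σ_{p,i} = (i, i+d, …, i+(p−1)d, m − p·i), p an odd prime dividing m, d = m/p, d/gcd(i,d) > 2, all
entries nonzero, of Hodge weight (p+1)/2 (Aoki 1987: represented by explicit algebraic cycles). Everything is decidable.
-/

namespace HodgeRepro0.P1.FermatCert

/-- the odd prime divisors of m -/
def oddPrimeDivisors (m : ℕ) : List ℕ := (List.range (m + 1)).filter (fun q => 3 ≤ q ∧ m % q = 0 ∧ Nat.Prime q)

/-- Aoki's p-standard element test for a block -/
abbrev IsAokiStd (m : ℕ) (bk : List ℕ) : Prop :=
  ∃ p ∈ oddPrimeDivisors m, ∃ i ∈ List.range m, 0 < i ∧ 2 < (m / p) / Nat.gcd i (m / p) ∧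
    ((bk : List ℕ) : Multiset ℕ) =
      ((((List.range p).map (fun k => (i + k * (m / p)) % m)) ++ [(m - (p * i) % m) % m] : List ℕ) : Multiset ℕ) ∧
    (∀ x ∈ bk, x ≠ 0) ∧ (∀ t ∈ unitsOf m, (bk.map (fun x => t * x % m)).sum = ((p + 1) / 2) * m)

/-- an elementary block in the sense of `IsShiodaCert` -/
abbrev IsElementary (m : ℕ) (bk : List ℕ) : Prop :=
  bk.sum % m = 0 ∧ (∀ t ∈ unitsOf m, (bk.map (fun x => t * x % m)).sum = (bk.length / 2) * m) ∧
  (bk.length = 2 ∨ bk.length = 4 ∨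
    (bk.length = 6 ∧ ∃ i ∈ [1, 2, 3, 4, 5], ∃ j ∈ [1, 2, 3, 4, 5], i < j ∧
      (bk.headD 0 + bk.getD i 0 + bk.getD j 0) % m = 0))

/-- the extended certificate predicate -/
abbrev IsShiodaCertExt (m : ℕ) (Phi S alpha : List ℕ) (extra : List ℕ) (blocks : List (List ℕ)) : Prop :=
  (∀ t ∈ unitsOf m, (t ∈ Phi) ≠ ((m - t) ∈ Phi)) ∧
  (∀ t ∈ unitsOf m, 2 * (S.filter (fun s => (Phi.map (fun x => t * x % m)).contains s)).length = S.length) ∧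
  (alpha.length = 3 ∧ alpha.sum % m = 0) ∧
  (∀ a ∈ extra, 0 < a ∧ a < m) ∧
  ((((S.map (fun u => alpha.map (fun x => u * x % m))).flatten ++ (extra.map (fun a => [a, m - a])).flatten : List ℕ) : Multiset ℕ) =
      ((blocks.flatten : List ℕ) : Multiset ℕ)) ∧
  (∀ bk ∈ blocks, IsElementary m bk ∨ IsAokiStd m bk)

/-- the (X23) instance: m = 48, Φ_(1,10), the quartic-subfield Weil family, one cancelling pair (24,24) -/
theorem zeta48_quartic_family :
    IsShiodaCertExt 48 [1, 5, 7, 11, 13, 17, 25, 29] [1, 19, 25, 43] [1, 10, 37] [24]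
      [[1, 24, 25, 46], [7, 10, 13, 31, 37, 46], [10, 19, 24, 43]] := by decide

end HodgeRepro0.P1.FermatCert
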